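import Summits.CriticalPhenomena.CardyFormulaZ2.Theses.CardyIKTransport
import Summits.CriticalPhenomena.CardyFormulaZ2.Theses.CardyDiluteOrbit

/-!
# Stub `stub_MixedRSW` of the line `pinned-diagram-exchange` (crux stmt-CriticalPhenomena-5076) — the BRIDGE from r4

Support file (`--supports stmt-CriticalPhenomena-5076`, lead c2; registered sub-goal `mixedRSW_of_diluteOrbit`).

`stub_MixedRSW` is, by name, the route decl `CardyIKTransport.IKMixedBoxCrossing`; the crux stmt-CriticalPhenomena-5911
driven by its own leads closes the TEXTUALLY IDENTICAL decl `CardyDiluteOrbit.IKMixedBoxCrossing`. This file records that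
the two are the same proposition, so that `IKMixedBoxCrossing_holds` of either route discharges the stub.
-/

namespace Summit.CriticalPhenomena.CardyFormulaZ2.Theorems.IKLinearTransport.PinnedDiagramExchange

/-- The two route decls `IKMixedBoxCrossing` (CardyIKTransport r4 = CardyDiluteOrbit stmt-5911) are the same proposition.
[folklore] -/
theorem mixedBoxCrossing_iff :
    Summit.CriticalPhenomena.CardyFormulaZ2.Theses.CardyIKTransport.IKMixedBoxCrossing ↔
      Summit.CriticalPhenomena.CardyFormulaZ2.Theses.CardyDiluteOrbit.IKMixedBoxCrossing := Iff.rfl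

/-- BRIDGE (registered sub-goal `mixedRSW_of_diluteOrbit`): the r4 crux of CardyDiluteOrbit gives `stub_MixedRSW`. [folklore] -/
theorem mixedRSW_of_diluteOrbit : Summit.CriticalPhenomena.CardyFormulaZ2.Theses.CardyDiluteOrbit.IKMixedBoxCrossing →
    Summit.CriticalPhenomena.CardyFormulaZ2.Theses.CardyIKTransport.IKMixedBoxCrossing := fun h => h

end Summit.CriticalPhenomena.CardyFormulaZ2.Theorems.IKLinearTransport.PinnedDiagramExchange
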